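import Summits.AtomisticToContinuum.FouriersLaw.Theses.CoercivePulse
import Summits.AtomisticToContinuum.FouriersLaw.Theorems.CageBudgetFeketeHeatVarianceCalculusLaplace
import HarnessLib

/-!
# `AbelRegularity` / Negative: the lacunary pulse and its Abel means (calculus)

Support file (`--supports stmt-AtomisticToContinuum-15384`) of the crux disprover (cdisprove) of the crux
`CoercivePulse.AbelRegularity` (stmt-AtomisticToContinuum-15384).  Part 1 of 2 (the 400-line rule): the calculus of the
LACUNARY PULSE `F(t) = Σₖ ρᵏ(e^{-ρᵏ|t|} − 2⁻⁸ e^{-ρᵏ|t|/256})`, `ρ = 2⁻¹⁶` — a superposition of relaxation–anti-relaxation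
epochs of zero signed area on geometrically separated time scales — written out in every signature (no definitions):

* §1 one scale `g_b(t) = b(e^{-bt} − 2⁻⁸e^{-bt/256})`: `|g_b| ≤ (255/256)b = g_b(0)` on `t ≥ 0`, Laplace transform
  `b/(ν+b) − (b/256)/(ν+b/256) = (255/256)bν/((ν+b)(ν+b/256)) ≥ 0` and its two regimes (`≤ 256ν/b`, `≤ b/ν`);
* §2 the pulse: absolute convergence, continuity (M-test), `F(0) = (255/256)(1−ρ)⁻¹ > 0`, `|F| ≤ F(0)`,
  Laplace integrability, decay `F(t) → 0` (Tannery);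
* §3 its Abel means as the convergent series `A(ν) = Σₖ[ρᵏ/(ν+ρᵏ) − (ρᵏ/256)/(ν+ρᵏ/256)] ≥ 0` (dominated convergence
  for series), and the two-sided evaluation: `A(ρⁿ/16) ≥ 15/17` (inside the `n`-th bump), `A(ρⁿ/4096) ≤ (1/8)(1−ρ)⁻¹`
  (inside the `n`-th gap; head/tail geometric bounds), plus the test sequences `ρⁿ/d → 0⁺`.

Part 2 (`Negative/TimeDomainOscillation.lean`) turns this into the witness theorem and the refuted strengthenings of the
crux / load-bearing hypotheses of the line `Sketch`.  Discrete prototype: Hardy 1907, `Σ(−1)ᵏx^{2ᵏ}` has no limit at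
`1⁻` (Montgomery–Vaughan 2007, Exercise 5.2.30).  Refuter seat refuter-cdisprove-stmt-AtomisticToContinuum-15384-0, 2026-08-17.
-/

noncomputable section

namespace Summit.AtomisticToContinuum.FouriersLaw.Theorems.AbelRegularity.Negative

open MeasureTheory Set Filter Topology
open Summit.AtomisticToContinuum.FouriersLaw.Theorems.HeatVarianceCalculus.CanonicalRigidity
  (integrableOn_exp_neg_mul_of_abs_le_pow)

/-! ## §1 One relaxation scale `g_b(t) = b (e^{-bt} - c e^{-cbt})`, `c = 1/256` -/

/-- Upper bound of one scale on `t ≥ 0`: `g_b(t) ≤ (255/256) b = g_b(0)`. [folklore] -/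
theorem lacunaryScale_le {b t : ℝ} (hb : 0 ≤ b) (ht : 0 ≤ t) :
    b * (Real.exp (-(b * t)) - 1 / 256 * Real.exp (-(b / 256 * t))) ≤ 255 / 256 * b := by
  have h1 : Real.exp (-(b * t)) ≤ Real.exp (-(b / 256 * t)) :=
    Real.exp_le_exp.2 (by nlinarith [mul_nonneg hb ht])
  have h2 : Real.exp (-(b / 256 * t)) ≤ 1 := by
    rw [Real.exp_le_one_iff]; nlinarith [mul_nonneg hb ht]
  have h3 : Real.exp (-(b * t)) - 1 / 256 * Real.exp (-(b / 256 * t)) ≤ 255 / 256 := by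
    nlinarith
  calc b * (Real.exp (-(b * t)) - 1 / 256 * Real.exp (-(b / 256 * t))) ≤ b * (255 / 256) :=
        mul_le_mul_of_nonneg_left h3 hb
    _ = 255 / 256 * b := by ring

/-- Lower bound of one scale on `t ≥ 0`: `-(255/256) b ≤ g_b(t)`. [folklore] -/
theorem neg_le_lacunaryScale {b t : ℝ} (hb : 0 ≤ b) (ht : 0 ≤ t) :
    -(255 / 256 * b) ≤ b * (Real.exp (-(b * t)) - 1 / 256 * Real.exp (-(b / 256 * t))) := by
  have h2 : Real.exp (-(b / 256 * t)) ≤ 1 := by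
    rw [Real.exp_le_one_iff]; nlinarith [mul_nonneg hb ht]
  have h3 : -(255 / 256) ≤ Real.exp (-(b * t)) - 1 / 256 * Real.exp (-(b / 256 * t)) := by
    nlinarith [Real.exp_pos (-(b * t))]
  calc -(255 / 256 * b) = b * (-(255 / 256)) := by ring
    _ ≤ b * (Real.exp (-(b * t)) - 1 / 256 * Real.exp (-(b / 256 * t))) :=
        mul_le_mul_of_nonneg_left h3 hb

/-- `|g_b(t)| ≤ (255/256) b` for `t ≥ 0`. [folklore] -/
theorem abs_lacunaryScale_le {b t : ℝ} (hb : 0 ≤ b) (ht : 0 ≤ t) :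
    |b * (Real.exp (-(b * t)) - 1 / 256 * Real.exp (-(b / 256 * t)))| ≤ 255 / 256 * b :=
  abs_le.2 ⟨neg_le_lacunaryScale hb ht, lacunaryScale_le hb ht⟩

/-- The value at `0`: `g_b(0) = (255/256) b`. [folklore] -/
theorem lacunaryScale_zero (b : ℝ) :
    b * (Real.exp (-(b * 0)) - 1 / 256 * Real.exp (-(b / 256 * 0))) = 255 / 256 * b := by
  simp; ring

/-- The Laplace transform of one scale: `∫₀^∞ e^{-νt} g_b(t) dt = b/(ν+b) - (b/256)/(ν+b/256)` (`ν > 0`,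
`b ≥ 0`), with integrability. [folklore] -/
theorem integral_exp_neg_mul_lacunaryScale {ν b : ℝ} (hν : 0 < ν) (hb : 0 ≤ b) :
    IntegrableOn (fun t : ℝ => Real.exp (-(ν * t)) *
        (b * (Real.exp (-(b * t)) - 1 / 256 * Real.exp (-(b / 256 * t))))) (Ioi 0) ∧
      ∫ t in Ioi (0:ℝ), Real.exp (-(ν * t)) *
          (b * (Real.exp (-(b * t)) - 1 / 256 * Real.exp (-(b / 256 * t)))) =
        b / (ν + b) - b / 256 / (ν + b / 256) := by
  -- the two pure exponentials
  have hE : ∀ a : ℝ, 0 < a → IntegrableOn (fun t : ℝ => Real.exp (-(a * t))) (Ioi 0) ∧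
      ∫ t in Ioi (0:ℝ), Real.exp (-(a * t)) = a⁻¹ := fun a ha => by
    refine ⟨by simpa only [neg_mul] using exp_neg_integrableOn_Ioi 0 ha, ?_⟩
    rw [show (fun t : ℝ => Real.exp (-(a * t))) = fun t => Real.exp (-a * t) from
        funext fun t => by rw [neg_mul],
      integral_exp_mul_Ioi (neg_lt_zero.mpr ha) 0, mul_zero, Real.exp_zero, neg_div, one_div, inv_neg, neg_neg]
  obtain ⟨i1, v1⟩ := hE (ν + b) (by positivity)
  obtain ⟨i2, v2⟩ := hE (ν + b / 256) (by positivity)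
  have e : (fun t : ℝ => Real.exp (-(ν * t)) *
      (b * (Real.exp (-(b * t)) - 1 / 256 * Real.exp (-(b / 256 * t))))) =
      fun t => b * Real.exp (-((ν + b) * t)) - b / 256 * Real.exp (-((ν + b / 256) * t)) := by
    funext t
    have h1 : Real.exp (-((ν + b) * t)) = Real.exp (-(ν * t)) * Real.exp (-(b * t)) := by
      rw [← Real.exp_add]; congr 1; ring
    have h2 : Real.exp (-((ν + b / 256) * t)) = Real.exp (-(ν * t)) * Real.exp (-(b / 256 * t)) := by
      rw [← Real.exp_add]; congr 1; ring
    rw [h1, h2]; ring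
  rw [e]
  refine ⟨(i1.const_mul b).sub (i2.const_mul (b / 256)), ?_⟩
  rw [integral_sub (i1.const_mul b) (i2.const_mul (b / 256)), integral_const_mul, integral_const_mul, v1, v2]
  simp only [div_eq_mul_inv]

/-- The Laplace term in closed form: `b/(ν+b) - (b/256)/(ν+b/256) = (255/256)·bν/((ν+b)(ν+b/256))`.
[folklore] -/
theorem lacunaryTerm_eq {ν b : ℝ} (hν : 0 < ν) (hb : 0 ≤ b) :
    b / (ν + b) - b / 256 / (ν + b / 256) = 255 / 256 * (b * ν) / ((ν + b) * (ν + b / 256)) := by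
  have h1 : ν + b ≠ 0 := by positivity
  have h2 : ν + b / 256 ≠ 0 := by positivity
  field_simp
  ring

/-- Each Laplace term is non-negative. [folklore] -/
theorem lacunaryTerm_nonneg {ν b : ℝ} (hν : 0 < ν) (hb : 0 ≤ b) :
    0 ≤ b / (ν + b) - b / 256 / (ν + b / 256) := by
  rw [lacunaryTerm_eq hν hb]; positivity

/-- Regime `b` large: the term is at most `256 ν / b`. [folklore] -/
theorem lacunaryTerm_le_of_pos {ν b : ℝ} (hν : 0 < ν) (hb : 0 < b) :
    b / (ν + b) - b / 256 / (ν + b / 256) ≤ 256 * ν / b := by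
  rw [lacunaryTerm_eq hν hb.le, div_le_div_iff₀ (by positivity) hb]
  -- 255/256 * (b ν) * b ≤ 256 ν (ν + b)(ν + b/256)
  nlinarith [mul_pos hν hb, mul_pos (mul_pos hν hb) hb, mul_pos (mul_pos hν hν) hb, sq_nonneg ν]

/-- Regime `b` small: the term is at most `b / ν`. [folklore] -/
theorem lacunaryTerm_le_div {ν b : ℝ} (hν : 0 < ν) (hb : 0 ≤ b) :
    b / (ν + b) - b / 256 / (ν + b / 256) ≤ b / ν := by
  have h1 : b / (ν + b) ≤ b / ν := div_le_div_of_nonneg_left hb hν (by linarith)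
  have h2 : 0 ≤ b / 256 / (ν + b / 256) := by positivity
  linarith


/-! ## §2 The lacunary pulse `F(t) = Σₖ g_{ρᵏ}(|t|)`, `ρ = 1/65536` -/

/-- Termwise bound `|g_{ρᵏ}(|t|)| ≤ (255/256) ρᵏ`. [folklore] -/
theorem abs_lacunaryPulse_term_le (k : ℕ) (t : ℝ) :
    |(1 / 65536 : ℝ) ^ k * (Real.exp (-((1 / 65536 : ℝ) ^ k * |t|)) -
        1 / 256 * Real.exp (-((1 / 65536 : ℝ) ^ k / 256 * |t|)))| ≤ 255 / 256 * (1 / 65536 : ℝ) ^ k :=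
  abs_lacunaryScale_le (pow_nonneg (by norm_num) k) (abs_nonneg t)

/-- The lacunary pulse converges absolutely at every `t`. [folklore] -/
theorem summable_lacunaryPulse (t : ℝ) :
    Summable fun k : ℕ => (1 / 65536 : ℝ) ^ k * (Real.exp (-((1 / 65536 : ℝ) ^ k * |t|)) -
        1 / 256 * Real.exp (-((1 / 65536 : ℝ) ^ k / 256 * |t|))) := by
  refine Summable.of_norm_bounded (g := fun k : ℕ => (1 / 65536 : ℝ) ^ k)
    (summable_geometric_of_lt_one (by norm_num) (by norm_num)) fun k => ?_
  rw [Real.norm_eq_abs]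
  exact (abs_lacunaryPulse_term_le k t).trans (by nlinarith [pow_nonneg (show (0:ℝ) ≤ 1 / 65536 by norm_num) k])

/-- The lacunary pulse is continuous (Weierstrass M-test). [folklore] -/
theorem continuous_lacunaryPulse :
    Continuous fun t : ℝ => ∑' k : ℕ, (1 / 65536 : ℝ) ^ k * (Real.exp (-((1 / 65536 : ℝ) ^ k * |t|)) -
        1 / 256 * Real.exp (-((1 / 65536 : ℝ) ^ k / 256 * |t|))) := by
  refine continuous_tsum (u := fun k : ℕ => (1 / 65536 : ℝ) ^ k) (fun k => by fun_prop)
    (summable_geometric_of_lt_one (by norm_num) (by norm_num)) fun k t => ?_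
  rw [Real.norm_eq_abs]
  exact (abs_lacunaryPulse_term_le k t).trans (by nlinarith [pow_nonneg (show (0:ℝ) ≤ 1 / 65536 by norm_num) k])

/-- The value at `0`: `F(0) = (255/256) (1 - ρ)⁻¹`. [folklore] -/
theorem lacunaryPulse_zero :
    (∑' k : ℕ, (1 / 65536 : ℝ) ^ k * (Real.exp (-((1 / 65536 : ℝ) ^ k * |(0:ℝ)|)) -
        1 / 256 * Real.exp (-((1 / 65536 : ℝ) ^ k / 256 * |(0:ℝ)|)))) = 255 / 256 * (1 - 1 / 65536 : ℝ)⁻¹ := by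
  rw [← tsum_geometric_of_lt_one (by norm_num) (by norm_num), ← tsum_mul_left]
  refine tsum_congr fun k => ?_
  rw [abs_zero, lacunaryScale_zero]

/-- `|F(t)| ≤ F(0)` for all `t`. [folklore] -/
theorem abs_lacunaryPulse_le (t : ℝ) :
    |∑' k : ℕ, (1 / 65536 : ℝ) ^ k * (Real.exp (-((1 / 65536 : ℝ) ^ k * |t|)) -
        1 / 256 * Real.exp (-((1 / 65536 : ℝ) ^ k / 256 * |t|)))| ≤
      ∑' k : ℕ, (1 / 65536 : ℝ) ^ k * (Real.exp (-((1 / 65536 : ℝ) ^ k * |(0:ℝ)|)) -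
        1 / 256 * Real.exp (-((1 / 65536 : ℝ) ^ k / 256 * |(0:ℝ)|))) := by
  rw [lacunaryPulse_zero, ← Real.norm_eq_abs]
  exact tsum_of_norm_bounded ((hasSum_geometric_of_lt_one (by norm_num) (by norm_num)).mul_left (255 / 256))
    fun k => by rw [Real.norm_eq_abs]; exact abs_lacunaryPulse_term_le k t

/-- `F(0) > 0`. [folklore] -/
theorem lacunaryPulse_zero_pos :
    0 < ∑' k : ℕ, (1 / 65536 : ℝ) ^ k * (Real.exp (-((1 / 65536 : ℝ) ^ k * |(0:ℝ)|)) -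
        1 / 256 * Real.exp (-((1 / 65536 : ℝ) ^ k / 256 * |(0:ℝ)|))) := by
  rw [lacunaryPulse_zero]; norm_num

/-- The lacunary pulse is Laplace-integrable on `(0, ∞)` for every `ν > 0`. [folklore] -/
theorem integrableOn_exp_neg_mul_lacunaryPulse {ν : ℝ} (hν : 0 < ν) :
    IntegrableOn (fun t : ℝ => Real.exp (-(ν * t)) *
      ∑' k : ℕ, (1 / 65536 : ℝ) ^ k * (Real.exp (-((1 / 65536 : ℝ) ^ k * |t|)) -
        1 / 256 * Real.exp (-((1 / 65536 : ℝ) ^ k / 256 * |t|)))) (Ioi 0) :=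
  integrableOn_exp_neg_mul_of_abs_le_pow continuous_lacunaryPulse (n := 0)
    (fun t _ => by rw [pow_zero, mul_one]; exact abs_lacunaryPulse_le t) hν

/-- The lacunary pulse decays: `F(t) → 0` as `t → +∞` (Tannery). [folklore] -/
theorem tendsto_lacunaryPulse_atTop :
    Tendsto (fun t : ℝ => ∑' k : ℕ, (1 / 65536 : ℝ) ^ k * (Real.exp (-((1 / 65536 : ℝ) ^ k * |t|)) -
        1 / 256 * Real.exp (-((1 / 65536 : ℝ) ^ k / 256 * |t|)))) atTop (𝓝 0) := by
  have h := tendsto_tsum_of_dominated_convergence (𝓕 := atTop) (g := fun _ : ℕ => (0:ℝ))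
    (f := fun (t : ℝ) (k : ℕ) => (1 / 65536 : ℝ) ^ k * (Real.exp (-((1 / 65536 : ℝ) ^ k * |t|)) -
        1 / 256 * Real.exp (-((1 / 65536 : ℝ) ^ k / 256 * |t|))))
    (bound := fun k => (1 / 65536 : ℝ) ^ k)
    (summable_geometric_of_lt_one (by norm_num) (by norm_num)) (fun k => ?_)
    (Eventually.of_forall fun t k => ?_)
  · simpa only [tsum_zero] using h
  · have hb : 0 < (1 / 65536 : ℝ) ^ k := pow_pos (by norm_num) k
    have h1 : Tendsto (fun t : ℝ => Real.exp (-((1 / 65536 : ℝ) ^ k * |t|))) atTop (𝓝 0) :=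
      Real.tendsto_exp_atBot.comp (tendsto_neg_atTop_atBot.comp
        ((tendsto_abs_atTop_atTop).const_mul_atTop hb))
    have h2 : Tendsto (fun t : ℝ => Real.exp (-((1 / 65536 : ℝ) ^ k / 256 * |t|))) atTop (𝓝 0) :=
      Real.tendsto_exp_atBot.comp (tendsto_neg_atTop_atBot.comp
        ((tendsto_abs_atTop_atTop).const_mul_atTop (by positivity)))
    have h3 := (h1.sub (h2.const_mul (1 / 256))).const_mul ((1 / 65536 : ℝ) ^ k)
    simpa using h3
  · rw [Real.norm_eq_abs]
    exact (abs_lacunaryPulse_term_le k t).trans (by nlinarith [pow_nonneg (show (0:ℝ) ≤ 1 / 65536 by norm_num) k])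


/-! ## §3 The Abel means `A(ν) = Σₖ [ρᵏ/(ν+ρᵏ) − (ρᵏ/256)/(ν+ρᵏ/256)]` of the lacunary pulse -/

/-- The Abel means of the lacunary pulse, as a convergent series of the scale terms (dominated convergence
for series, dominating function `e^{-νt} Σₖ ρᵏ`). [folklore] -/
theorem hasSum_abelMeans_lacunaryPulse {ν : ℝ} (hν : 0 < ν) :
    HasSum (fun k : ℕ => (1 / 65536 : ℝ) ^ k / (ν + (1 / 65536 : ℝ) ^ k) -
        (1 / 65536 : ℝ) ^ k / 256 / (ν + (1 / 65536 : ℝ) ^ k / 256))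
      (∫ t in Ioi (0:ℝ), Real.exp (-(ν * t)) *
        ∑' k : ℕ, (1 / 65536 : ℝ) ^ k * (Real.exp (-((1 / 65536 : ℝ) ^ k * |t|)) -
          1 / 256 * Real.exp (-((1 / 65536 : ℝ) ^ k / 256 * |t|)))) := by
  have hgeom : Summable fun k : ℕ => (1 / 65536 : ℝ) ^ k :=
    summable_geometric_of_lt_one (by norm_num) (by norm_num)
  have hE : IntegrableOn (fun t : ℝ => Real.exp (-(ν * t))) (Ioi 0) := by
    simpa only [neg_mul] using exp_neg_integrableOn_Ioi 0 hν
  have key := hasSum_integral_of_dominated_convergence (μ := volume.restrict (Ioi (0:ℝ)))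
    (F := fun (k : ℕ) (t : ℝ) => Real.exp (-(ν * t)) * ((1 / 65536 : ℝ) ^ k *
      (Real.exp (-((1 / 65536 : ℝ) ^ k * |t|)) - 1 / 256 * Real.exp (-((1 / 65536 : ℝ) ^ k / 256 * |t|)))))
    (f := fun t : ℝ => Real.exp (-(ν * t)) * ∑' k : ℕ, (1 / 65536 : ℝ) ^ k *
      (Real.exp (-((1 / 65536 : ℝ) ^ k * |t|)) - 1 / 256 * Real.exp (-((1 / 65536 : ℝ) ^ k / 256 * |t|))))
    (fun (k : ℕ) (t : ℝ) => Real.exp (-(ν * t)) * (1 / 65536 : ℝ) ^ k)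
    (fun k => Continuous.aestronglyMeasurable (by fun_prop))
    (fun k => Eventually.of_forall fun t => ?_)
    (Eventually.of_forall fun t => hgeom.mul_left _) ?_
    (Eventually.of_forall fun t => (summable_lacunaryPulse t).hasSum.mul_left _)
  · have e : (fun k : ℕ => (1 / 65536 : ℝ) ^ k / (ν + (1 / 65536 : ℝ) ^ k) -
        (1 / 65536 : ℝ) ^ k / 256 / (ν + (1 / 65536 : ℝ) ^ k / 256)) =
        fun n : ℕ => ∫ a in Ioi (0:ℝ), Real.exp (-(ν * a)) * ((1 / 65536 : ℝ) ^ n *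
          (Real.exp (-((1 / 65536 : ℝ) ^ n * |a|)) - 1 / 256 * Real.exp (-((1 / 65536 : ℝ) ^ n / 256 * |a|)))) := by
      funext k
      have hb : 0 ≤ (1 / 65536 : ℝ) ^ k := pow_nonneg (by norm_num) k
      rw [← (integral_exp_neg_mul_lacunaryScale hν hb).2]
      refine setIntegral_congr_fun measurableSet_Ioi fun t ht => ?_
      simp only [abs_of_pos (mem_Ioi.1 ht)]
    rw [e]
    exact key
  · rw [norm_mul, Real.norm_eq_abs, Real.norm_eq_abs, abs_of_pos (Real.exp_pos _)]
    refine mul_le_mul_of_nonneg_left ((abs_lacunaryPulse_term_le k t).trans ?_) (Real.exp_pos _).le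
    nlinarith [pow_nonneg (show (0:ℝ) ≤ 1 / 65536 by norm_num) k]
  · have e : (fun t : ℝ => ∑' k : ℕ, Real.exp (-(ν * t)) * (1 / 65536 : ℝ) ^ k) =
        fun t => Real.exp (-(ν * t)) * (1 - 1 / 65536 : ℝ)⁻¹ := funext fun t => by
      rw [tsum_mul_left, tsum_geometric_of_lt_one (by norm_num) (by norm_num)]
    rw [e]
    exact hE.mul_const _

/-- The Abel means of the lacunary pulse are non-negative. [folklore] -/
theorem abelMeans_lacunaryPulse_nonneg {ν : ℝ} (hν : 0 < ν) :
    0 ≤ ∫ t in Ioi (0:ℝ), Real.exp (-(ν * t)) *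
        ∑' k : ℕ, (1 / 65536 : ℝ) ^ k * (Real.exp (-((1 / 65536 : ℝ) ^ k * |t|)) -
          1 / 256 * Real.exp (-((1 / 65536 : ℝ) ^ k / 256 * |t|))) :=
  (hasSum_abelMeans_lacunaryPulse hν).nonneg fun k => lacunaryTerm_nonneg hν (pow_nonneg (by norm_num) k)

/-- **Inside the `n`-th bump** (`ν = ρⁿ/16`) the Abel means are `≥ 15/17` (the `n`-th term alone). [folklore] -/
theorem abelMeans_lacunaryPulse_ge (n : ℕ) :
    15 / 17 ≤ ∫ t in Ioi (0:ℝ), Real.exp (-((1 / 65536 : ℝ) ^ n / 16 * t)) *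
        ∑' k : ℕ, (1 / 65536 : ℝ) ^ k * (Real.exp (-((1 / 65536 : ℝ) ^ k * |t|)) -
          1 / 256 * Real.exp (-((1 / 65536 : ℝ) ^ k / 256 * |t|))) := by
  have hb : 0 < (1 / 65536 : ℝ) ^ n := pow_pos (by norm_num) n
  have hν : 0 < (1 / 65536 : ℝ) ^ n / 16 := by positivity
  have h := le_hasSum (hasSum_abelMeans_lacunaryPulse hν) n
    fun j _ => lacunaryTerm_nonneg hν (pow_nonneg (by norm_num) j)
  have e : (1 / 65536 : ℝ) ^ n / ((1 / 65536 : ℝ) ^ n / 16 + (1 / 65536 : ℝ) ^ n) -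
      (1 / 65536 : ℝ) ^ n / 256 / ((1 / 65536 : ℝ) ^ n / 16 + (1 / 65536 : ℝ) ^ n / 256) = 15 / 17 := by
    field_simp
    ring
  linarith

/-- **Inside the `n`-th gap** (`ν = ρⁿ/4096`) the Abel means are `≤ (1/8)(1-ρ)⁻¹ < 15/17`: the terms of index
`≤ n` are `≤ ρⁿ⁻ᵏ/16`, those of index `> n` are `≤ ρᵏ⁻ⁿ⁻¹/16`. [folklore] -/
theorem abelMeans_lacunaryPulse_le (n : ℕ) :
    ∫ t in Ioi (0:ℝ), Real.exp (-((1 / 65536 : ℝ) ^ n / 4096 * t)) *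
        ∑' k : ℕ, (1 / 65536 : ℝ) ^ k * (Real.exp (-((1 / 65536 : ℝ) ^ k * |t|)) -
          1 / 256 * Real.exp (-((1 / 65536 : ℝ) ^ k / 256 * |t|))) ≤ 1 / 8 * (1 - 1 / 65536 : ℝ)⁻¹ := by
  have hρ0 : (0:ℝ) ≤ 1 / 65536 := by norm_num
  have hρ1 : (1 / 65536 : ℝ) < 1 := by norm_num
  have hb : 0 < (1 / 65536 : ℝ) ^ n := pow_pos (by norm_num) n
  have hν : 0 < (1 / 65536 : ℝ) ^ n / 4096 := by positivity
  have hS := hasSum_abelMeans_lacunaryPulse hν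
  set f : ℕ → ℝ := fun k => (1 / 65536 : ℝ) ^ k / ((1 / 65536 : ℝ) ^ n / 4096 + (1 / 65536 : ℝ) ^ k) -
    (1 / 65536 : ℝ) ^ k / 256 / ((1 / 65536 : ℝ) ^ n / 4096 + (1 / 65536 : ℝ) ^ k / 256) with hf_def
  have hf : Summable f := hS.summable
  rw [← hS.tsum_eq, ← hf.sum_add_tsum_nat_add (n + 1)]
  have hgeom : Summable fun j : ℕ => (1 / 65536 : ℝ) ^ j := summable_geometric_of_lt_one hρ0 hρ1
  have hG : ∑' j : ℕ, (1 / 65536 : ℝ) ^ j = (1 - 1 / 65536 : ℝ)⁻¹ := tsum_geometric_of_lt_one hρ0 hρ1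
  -- head: indices `k ≤ n`
  have hhead : ∑ k ∈ Finset.range (n + 1), f k ≤ 1 / 16 * (1 - 1 / 65536 : ℝ)⁻¹ := by
    have h1 : ∀ k ∈ Finset.range (n + 1), f k ≤ (1 / 65536 : ℝ) ^ (n - k) / 16 := by
      intro k hk
      have hkn : k ≤ n := Nat.lt_succ_iff.1 (Finset.mem_range.1 hk)
      have hbk : 0 < (1 / 65536 : ℝ) ^ k := pow_pos (by norm_num) k
      refine (lacunaryTerm_le_of_pos hν hbk).trans (le_of_eq ?_)
      have e : (1 / 65536 : ℝ) ^ n = (1 / 65536 : ℝ) ^ (n - k) * (1 / 65536 : ℝ) ^ k := by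
        rw [← pow_add, Nat.sub_add_cancel hkn]
      rw [e]
      field_simp
      ring
    have h2 : ∑ k ∈ Finset.range (n + 1), (1 / 65536 : ℝ) ^ (n - k) / 16 =
        ∑ j ∈ Finset.range (n + 1), (1 / 65536 : ℝ) ^ j / 16 := by
      have h := Finset.sum_range_reflect (fun j => (1 / 65536 : ℝ) ^ j / 16) (n + 1)
      simp only [Nat.add_sub_cancel] at h
      exact h
    have h3 : ∑ j ∈ Finset.range (n + 1), (1 / 65536 : ℝ) ^ j ≤ ∑' j : ℕ, (1 / 65536 : ℝ) ^ j :=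
      hgeom.sum_le_tsum _ fun j _ => pow_nonneg hρ0 j
    calc ∑ k ∈ Finset.range (n + 1), f k ≤ ∑ k ∈ Finset.range (n + 1), (1 / 65536 : ℝ) ^ (n - k) / 16 :=
          Finset.sum_le_sum h1
      _ = 1 / 16 * ∑ j ∈ Finset.range (n + 1), (1 / 65536 : ℝ) ^ j := by
          rw [h2, Finset.mul_sum]
          exact Finset.sum_congr rfl fun j _ => by ring
      _ ≤ 1 / 16 * (1 - 1 / 65536 : ℝ)⁻¹ := by rw [← hG]; exact mul_le_mul_of_nonneg_left h3 (by norm_num)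
  -- tail: indices `k = i + (n+1)`
  have htail : ∑' i : ℕ, f (i + (n + 1)) ≤ 1 / 16 * (1 - 1 / 65536 : ℝ)⁻¹ := by
    have h1 : ∀ i : ℕ, f (i + (n + 1)) ≤ 1 / 16 * (1 / 65536 : ℝ) ^ i := by
      intro i
      refine (lacunaryTerm_le_div hν (pow_nonneg hρ0 _)).trans (le_of_eq ?_)
      rw [pow_add, pow_succ]
      field_simp
      norm_num
    have h2 : Summable fun i : ℕ => f (i + (n + 1)) := (summable_nat_add_iff (n + 1)).2 hf
    calc ∑' i : ℕ, f (i + (n + 1)) ≤ ∑' i : ℕ, 1 / 16 * (1 / 65536 : ℝ) ^ i :=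
          h2.tsum_le_tsum h1 (hgeom.mul_left _)
      _ = 1 / 16 * (1 - 1 / 65536 : ℝ)⁻¹ := by rw [tsum_mul_left, hG]
  linarith

/-- The two test sequences `ρⁿ/16` (bumps) and `ρⁿ/4096` (gaps) tend to `0` from the right. [folklore] -/
theorem tendsto_lacunaryScales_div (d : ℝ) (hd : 0 < d) :
    Tendsto (fun n : ℕ => (1 / 65536 : ℝ) ^ n / d) atTop (𝓝[>] 0) := by
  refine tendsto_nhdsWithin_iff.2 ⟨?_, Eventually.of_forall fun n => mem_Ioi.2 (by positivity)⟩
  have h := (tendsto_pow_atTop_nhds_zero_of_lt_one (show (0:ℝ) ≤ 1 / 65536 by norm_num)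
    (by norm_num)).div_const d
  rw [zero_div] at h
  exact h

end Summit.AtomisticToContinuum.FouriersLaw.Theorems.AbelRegularity.Negative

end
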